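import Summits.QuantumFields.QCD.Theses.PauliWegnerSea
import Summits.QuantumFields.QCD.Theses.WilsonMobilityGap
import Summits.QuantumFields.QCD.Theorems.GluonicCompletion.Negative.Threshold
import Summits.QuantumFields.QCD.Theorems.PauliWegnerSeaGluonicCompletionCutoffWindow
import Summits.QuantumFields.QCD.Theorems.PauliWegnerSeaGluonicCompletionQuarkLocality
import Summits.QuantumFields.QCD.Theorems.PauliWegnerSeaGluonicCompletionDiagonal

/-!
# Line `certified-sea-threshold-graft` — checked skeleton for crux stmt-QuantumFields-9152
(`Summit.QuantumFields.QCD.Theses.PauliWegnerSea.GluonicCompletion`, shared rfl-equal with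
`WilsonMobilityGap.GluonicCompletion`)

Crux `G`: `∀ N_f ∈ {2,3}, H N_f → QCDOf N_f`, `H N_f = ∃ reg, HBody N_f reg` (mass scaling, asymptotic
scaling and, for every `m > 0`, clauses (i)–(iv) of `MobilityGap` plus the phase-quenched flavour decay).

Line (idea card `Cruxes/GluonicCompletion/Ideas/certified-sea-threshold-graft.md`, triage TRIAGE-r1-{1,2,3}):
prove the HEAVY-THRESHOLD BODY ALONG H's OWN REGULARISATION, up to locally-`m`-uniform subsequences
(the repaired transfer `C⁺′` of the triage: `∃ φ StrictMono` before `∃ M₀`), and discharge `C⁺′ → G` by the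
landed threshold reading `Negative.qcdOf_iff_threshold` (audit g7) applied to the subsequence regularisation.

Stubs (registered; status after wave 1 of the lead, 2026-08-16: `stub_cutoffWindow` CLOSED p72607,
`stub_quarkLocality` CLOSED p73061, `stub_diagonal` CLOSED p73776 — imported from `Theorems/`; `stub_largeMassRate`,
`stub_latticeGapAlongH`, `stub_continuumAlongH` OPEN, `sorry`): `stub_cutoffWindow` (H ⇒ bare masses never lattice-massive: the
cutoff-scale face of the heavy-side window guard; provable now), `stub_largeMassRate` (H-sharpening: clause
(ii) at a rate linear in the lightest renormalised mass; open, easier than stmt-9150), `stub_quarkLocality`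
(clause (ii) ⇒ configuration-wise quark locality with an `|w|`-integrable random constant; provable now),
`stub_latticeGapAlongH` (the all-volume lattice gap above a threshold along `reg` — where the sign defects
and the gluonic clustering live; open, contains the Yang–Mills lattice core in its robust form),
`stub_continuumAlongH` (subsequential continuum limit, OS axioms, non-triviality and `T.HasMassGap` above a
threshold along `reg`, locally uniformly in `m`, given the lattice gap — the sign is met only at the
scheme's own side `2L_k+1`, where clause (iv) is a factor-2 licence; open), `stub_diagonal` (locally
uniform subsequential body ⇒ one subsequence for all `m`: Lindelöf + diagonal + heredity; provable now).
The logic `composition_closed` (stub statements ⇒ crux) is sorry-free; the skeleton theorems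
`GluonicCompletion_of` / `GluonicCompletion_of_wilsonMobilityGap` conclude the two route copies BY NAME from the stubs.
-/

namespace Summit.QuantumFields.QCD.Cruxes.GluonicCompletion.CertifiedSeaThresholdGraft

open scoped BigOperators
open MeasureTheory Filter Literature.MathematicalPhysics.QuantumFieldTheory
  Literature.MathematicalPhysics.QuantumLattice Literature.Probability.LatticeModels

noncomputable section

/-! ### §0 Packaging (verbatim copies; `Iff.rfl` against the route decl) -/

/-- The BODY of the hypothesis `H N_f` of the crux for a given regularisation `reg` — VERBATIM the text of
`PauliWegnerSea.GluonicCompletion` between `∃ reg : QCDRegularisation Nf,` and `→ QCDOf Nf`. -/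
def HBody (Nf : ℕ) (reg : QCDRegularisation Nf) : Prop :=
  reg.HasMassScaling ∧ (reg.scheme 0 0 0).HasAsymptoticScaling ∧ ∀ m : Fin Nf → ℝ, (∀ f, 0 < m f) → ((∀ f : Fin Nf, ∀ᶠ k in atTop, -1 < reg.mcrit k + reg.a k * m f / reg.Zm k) ∧ (∃ s δ C : ℝ, 0 < s ∧ s < 1 ∧ 0 < δ ∧ ∀ᶠ k in atTop, ∀ S : ℕ, reg.L k ≤ S → ∀ (f : Fin Nf) (v : Literature.Probability.LatticeModels.Site 4), v ∈ box 4 S → (∫ U : GaugeConfig 4 (2 * S + 1) (Matrix.specialUnitaryGroup (Fin 3) ℂ), ‖(diracMatrix U fun fl => reg.mcrit k + reg.a k * m fl / reg.Zm k).det‖ * (∑ a : Fin 3, ∑ i : Fin 4, ∑ b : Fin 3, ∑ j : Fin 4, ‖(diracMatrix U fun fl => reg.mcrit k + reg.a k * m fl / reg.Zm k)⁻¹ (quarkEquiv (f, (Torus.proj (2 * S + 1) 0, a, i))) (quarkEquiv (f, (Torus.proj (2 * S + 1) (v), b, j)))‖) ^ s ∂(wilsonMeasure (fundamentalRep (Fin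 3)) (reg.β k))) / (∫ U : GaugeConfig 4 (2 * S + 1) (Matrix.specialUnitaryGroup (Fin 3) ℂ), ‖(diracMatrix U fun fl => reg.mcrit k + reg.a k * m fl / reg.Zm k).det‖ ∂(wilsonMeasure (fundamentalRep (Fin 3)) (reg.β k))) ≤ C * Real.exp (-(δ * (reg.a k * ‖v‖)))) ∧ (∃ s c₀ C₁ p : ℝ, 0 < s ∧ s < 1 ∧ 0 < c₀ ∧ ∀ᶠ k in atTop, ∀ S : ℕ, reg.L k ≤ S → ∀ (f : Fin Nf) (n : ℕ), n ≤ S → c₀ * Real.exp (-(C₁ * (reg.a k * n) + p * Real.log (n + 1))) ≤ (∫ U : GaugeConfig 4 (2 * S + 1) (Matrix.specialUnitaryGroup (Fin 3) ℂ), ‖(diracMatrix U fun fl => reg.mcrit k + reg.a k * m fl / reg.Zm k).det‖ * (∑ a : Fin 3, ∑ i : Fin 4, ∑ b : Fin 3, ∑ j : Fin 4, ‖(diracMatrix U fun fl => reg.mcrit k + reg.a k * m fl / reg.Zm k)⁻¹ (quarkEquiv (f, (Torus.proj (2 * S + 1) 0, a, i))) (quarkEquiv (f, (Torus.proj (2 *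 S + 1) (Pi.single 0 (n : ℤ)), b, j)))‖) ^ s ∂(wilsonMeasure (fundamentalRep (Fin 3)) (reg.β k))) / (∫ U : GaugeConfig 4 (2 * S + 1) (Matrix.specialUnitaryGroup (Fin 3) ℂ), ‖(diracMatrix U fun fl => reg.mcrit k + reg.a k * m fl / reg.Zm k).det‖ ∂(wilsonMeasure (fundamentalRep (Fin 3)) (reg.β k)))) ∧ (∀ᶠ k in atTop, (1 / 2 : ℝ) ≤ ‖∫ U : GaugeConfig 4 (2 * reg.L k + 1) (Matrix.specialUnitaryGroup (Fin 3) ℂ), (diracMatrix U fun fl => reg.mcrit k + reg.a k * m fl / reg.Zm k).det ∂(wilsonMeasure (fundamentalRep (Fin 3)) (reg.β k))‖ / (∫ U : GaugeConfig 4 (2 * reg.L k + 1) (Matrix.specialUnitaryGroup (Fin 3) ℂ), ‖(diracMatrix U fun fl => reg.mcrit k + reg.a k * m fl / reg.Zm k).det‖ ∂(wilsonMeasure (fundamentalRep (Fin 3)) (reg.β k))))) ∧ (∃ δ' : ℝ, 0 < δ' ∧ ∀ (R R' : ℕ) (A : QCDLatticeObservable Nf R) (B : QCDLatticeObservable Nf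 R'), (∃ (f₀ : Fin Nf) (q : ℤ), q ≠ 0 ∧ ∀ (θ : ℝ) (U : LGConfig 4 (Matrix.specialUnitaryGroup (Fin 3) ℂ)), ExteriorAlgebra.map (LinearMap.pi fun w => (Sum.elim (fun i => if (boxQuarkEquiv.symm i).1 = f₀ then Complex.exp (-((θ : ℂ) * Complex.I)) else 1) (fun i => if (boxQuarkEquiv.symm i).1 = f₀ then Complex.exp ((θ : ℂ) * Complex.I) else 1) (ofLex w)) • LinearMap.proj w) (A.F U) = Complex.exp (((q : ℝ) * θ : ℝ) * Complex.I) • A.F U) → ∃ C' : ℝ, ∀ᶠ k in atTop, ∀ S : ℕ, reg.L k ≤ S → ∀ n : ℕ, n ≤ S → ‖(∫ U : GaugeConfig 4 (2 * S + 1) (Matrix.specialUnitaryGroup (Fin 3) ℂ), (‖(diracMatrix U fun fl => reg.mcrit k + reg.a k * m fl / reg.Zm k).det‖ : ℂ) * (fermiIntegral (A.onTorus (2 * S + 1) 0 U * B.onTorus (2 * S + 1) (Pi.single 0 (n : ℤ)) U * fermiBoltzmann U fun fl => reg.mcrit k + reg.a k * m fl / reg.Zm k) / fermiIntegral (fermiBoltzmann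 U fun fl => reg.mcrit k + reg.a k * m fl / reg.Zm k)) ∂(wilsonMeasure (fundamentalRep (Fin 3)) (reg.β k))) / (∫ U : GaugeConfig 4 (2 * S + 1) (Matrix.specialUnitaryGroup (Fin 3) ℂ), (‖(diracMatrix U fun fl => reg.mcrit k + reg.a k * m fl / reg.Zm k).det‖ : ℂ) ∂(wilsonMeasure (fundamentalRep (Fin 3)) (reg.β k)))‖ ≤ C' * Real.exp (-(δ' * (reg.a k * n))))

/-- The crux, re-read through `HBody` (definitional). -/
theorem gluonicCompletion_iff :
    Summit.QuantumFields.QCD.Theses.PauliWegnerSea.GluonicCompletion ↔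
      ∀ Nf : ℕ, Nf = 2 ∨ Nf = 3 → (∃ reg : QCDRegularisation Nf, HBody Nf reg) → QCDOf Nf :=
  Iff.rfl

/-- The BODY of `QCDOf N_f` at one mass tuple `m` along the regularisation `reg` (verbatim the matrix of
`QCDOf` / of `Negative.qcdOf_iff_threshold`): species renormalisations and OS data with `IsQCDAlong`,
non-trivial non-Gaussian glue, non-decoupled flavour-changing pseudoscalars, and one gap `Δ > 0` of the
continuum data and of the lattice theory at the same bare parameters. -/
def Body (Nf : ℕ) (reg : QCDRegularisation Nf) (m : Fin Nf → ℝ) : Prop :=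
  ∃ (z shift : QCDField Nf → ℕ → ℝ) (T : OSData (QCDField Nf) 4),
    IsQCDAlong (reg.scheme m z shift) T ∧ T.IsNontrivial QCDField.glue ∧ T.IsNonGaussian QCDField.glue ∧
      (∀ f g : Fin Nf, f ≠ g → T.IsNontrivial (QCDField.pseudoRe f g)) ∧
        ∃ Δ > 0, T.HasMassGap Δ ∧ (reg.scheme m z shift).HasLatticeMassGap Δ

/-- The threshold reading of `QCDOf` (landed, `Negative.qcdOf_iff_threshold`, audit g7) in terms of `Body`. -/
theorem qcdOf_iff_threshold_body (Nf : ℕ) :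
    QCDOf Nf ↔ ∃ M₀ : ℝ, 0 ≤ M₀ ∧ ∃ reg : QCDRegularisation Nf,
      reg.HasMassScaling ∧ ∀ m : Fin Nf → ℝ, (∀ f, M₀ < m f) → Body Nf reg m :=
  Summit.QuantumFields.QCD.Theorems.GluonicCompletion.Negative.qcdOf_iff_threshold Nf

/-- **The subsequence regularisation** `reg ∘ φ` (`φ` strictly increasing): spacings, couplings, volumes,
critical masses and `Z_m` precomposed with `φ`; `a ∘ φ → 0` and `(a L) ∘ φ → ∞` by `StrictMono.tendsto_atTop`.
This is the "passing to subsequences" the crux's informal text allows for `reg′` and the repair of the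
card's transfer demanded by all three triagers (`∃ φ, StrictMono φ` before `∃ M₀`). -/
def subseqReg {Nf : ℕ} (reg : QCDRegularisation Nf) (φ : ℕ → ℕ) (hφ : StrictMono φ) :
    QCDRegularisation Nf where
  a k := reg.a (φ k)
  a_pos k := reg.a_pos (φ k)
  tendsto_a := reg.tendsto_a.comp hφ.tendsto_atTop
  β k := reg.β (φ k)
  L k := reg.L (φ k)
  tendsto_L := reg.tendsto_L.comp hφ.tendsto_atTop
  mcrit k := reg.mcrit (φ k)
  Zm k := reg.Zm (φ k)
  Zm_pos k := reg.Zm_pos (φ k)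

/-- Leading-log mass scaling passes to subsequences. -/
theorem hasMassScaling_subseqReg {Nf : ℕ} (reg : QCDRegularisation Nf) (φ : ℕ → ℕ)
    (hφ : StrictMono φ) (h : reg.HasMassScaling) : (subseqReg reg φ hφ).HasMassScaling := by
  obtain ⟨c, hc, ht⟩ := h
  exact ⟨c, hc, ht.comp hφ.tendsto_atTop⟩

/-- **Locally-`m`-uniform subsequential body above the threshold `M₀` along `reg`**: every mass tuple
above `M₀` has a neighbourhood on which, from EVERY subsequence `ψ`, a further subsequence `φ` can be
extracted along which `Body` holds for all tuples of the neighbourhood simultaneously. This is the honest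
output of a stability-plus-compactness construction (catalogued barrier `UVStabilityNonUniqueness`: bounds
never force full-sequence convergence) and it displays the "∀m hole" (FINDINGS-ideator1 F3, TRIAGE S2):
the construction, not `H`, must supply the local uniformity in `m`. -/
def LocUnifSubseqBody (Nf : ℕ) (reg : QCDRegularisation Nf) (M₀ : ℝ) : Prop :=
  ∀ m₀ : Fin Nf → ℝ, (∀ f, M₀ < m₀ f) → ∃ ε : ℝ, 0 < ε ∧
    ∀ (ψ : ℕ → ℕ) (hψ : StrictMono ψ), ∃ (φ : ℕ → ℕ) (hφ : StrictMono φ),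
      ∀ m : Fin Nf → ℝ, (∀ f, M₀ < m f) → (∀ f, |m f - m₀ f| < ε) →
        Body Nf (subseqReg (subseqReg reg ψ hψ) φ hφ) m

/-! ### §1 Clause (ii) with its constants exposed (verbatim integrands of the crux) -/

/-- The phase-quenched fractional moment of the flavour-`f` quark propagator between the origin and `v` on
the torus of side `2S+1` at step `k` — VERBATIM the quantity of clause (ii) of the crux's hypothesis. -/
def fmMoment {Nf : ℕ} (reg : QCDRegularisation Nf) (m : Fin Nf → ℝ) (s : ℝ) (k S : ℕ)
    (f : Fin Nf) (v : Site 4) : ℝ :=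
  (∫ U : GaugeConfig 4 (2 * S + 1) (Matrix.specialUnitaryGroup (Fin 3) ℂ),
      ‖(diracMatrix U fun fl => reg.mcrit k + reg.a k * m fl / reg.Zm k).det‖ *
        (∑ a : Fin 3, ∑ i : Fin 4, ∑ b : Fin 3, ∑ j : Fin 4,
          ‖(diracMatrix U fun fl => reg.mcrit k + reg.a k * m fl / reg.Zm k)⁻¹
              (quarkEquiv (f, (Torus.proj (2 * S + 1) 0, a, i)))
              (quarkEquiv (f, (Torus.proj (2 * S + 1) v, b, j)))‖) ^ s
      ∂(wilsonMeasure (fundamentalRep (Fin 3)) (reg.β k))) /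
    (∫ U : GaugeConfig 4 (2 * S + 1) (Matrix.specialUnitaryGroup (Fin 3) ℂ),
      ‖(diracMatrix U fun fl => reg.mcrit k + reg.a k * m fl / reg.Zm k).det‖
      ∂(wilsonMeasure (fundamentalRep (Fin 3)) (reg.β k)))

/-- The phase-quenched expectation of the WEIGHTED SUM over all endpoints `v` of the box, weights
`e^{δ a_k ‖v‖/2} (1+‖v‖)^{-5}` — the configuration-wise ("almost-sure") face of clause (ii):
`X_v(U) ≤ A(U) (1+‖v‖)^5 e^{-δ a_k‖v‖/2}` with `E_{|w|}[A] ≤ C'`. -/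
def fmWeightedSum {Nf : ℕ} (reg : QCDRegularisation Nf) (m : Fin Nf → ℝ) (s δ : ℝ) (k S : ℕ)
    (f : Fin Nf) : ℝ :=
  (∫ U : GaugeConfig 4 (2 * S + 1) (Matrix.specialUnitaryGroup (Fin 3) ℂ),
      ‖(diracMatrix U fun fl => reg.mcrit k + reg.a k * m fl / reg.Zm k).det‖ *
        ∑ v ∈ box 4 S, Real.exp (δ * (reg.a k * ‖v‖) / 2) * ((1 + ‖v‖) ^ 5)⁻¹ *
          (∑ a : Fin 3, ∑ i : Fin 4, ∑ b : Fin 3, ∑ j : Fin 4,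
            ‖(diracMatrix U fun fl => reg.mcrit k + reg.a k * m fl / reg.Zm k)⁻¹
                (quarkEquiv (f, (Torus.proj (2 * S + 1) 0, a, i)))
                (quarkEquiv (f, (Torus.proj (2 * S + 1) v, b, j)))‖) ^ s
      ∂(wilsonMeasure (fundamentalRep (Fin 3)) (reg.β k))) /
    (∫ U : GaugeConfig 4 (2 * S + 1) (Matrix.specialUnitaryGroup (Fin 3) ℂ),
      ‖(diracMatrix U fun fl => reg.mcrit k + reg.a k * m fl / reg.Zm k).det‖
      ∂(wilsonMeasure (fundamentalRep (Fin 3)) (reg.β k)))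

/-- Clause (ii) of the crux's hypothesis for `(reg, m)` with its constants `(s, δ, C)` exposed. -/
def ClauseII {Nf : ℕ} (reg : QCDRegularisation Nf) (m : Fin Nf → ℝ) (s δ C : ℝ) : Prop :=
  0 < s ∧ s < 1 ∧ 0 < δ ∧ ∀ᶠ k in atTop, ∀ S : ℕ, reg.L k ≤ S → ∀ (f : Fin Nf) (v : Site 4),
    v ∈ box 4 S → fmMoment reg m s k S f v ≤ C * Real.exp (-(δ * (reg.a k * ‖v‖)))

/-! ### §2 The intermediate statements of the line (named so that the registry shows the logical shape) -/

/-- **Cutoff window** (heavy-side window guard at the cutoff scale): along `reg` the bare Wilson masses of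
every positive mass tuple are eventually below every positive level — an `H`-regularisation is never
lattice-massive (with clause (i) the bare masses sit eventually in `(-1, ε)`: critically tuned from the
infrared, the starting window of a forward block-RG flow along PRESCRIBED bare data). -/
def CutoffWindowAt (Nf : ℕ) (reg : QCDRegularisation Nf) : Prop :=
  ∀ m : Fin Nf → ℝ, (∀ f, 0 < m f) → ∀ (f : Fin Nf) (ε : ℝ), 0 < ε →
    ∀ᶠ k in atTop, reg.mcrit k + reg.a k * m f / reg.Zm k < ε

/-- **Large-mass rate** (the `H`-sharpening the graft runs on; idea card obstruction (9), TRIAGE r1-1 (b),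
r1-2 (4)): in the heavy corner clause (ii) holds at a rate LINEAR in any common lower bound `μ` of the
renormalised masses, `δ ≥ c μ - C₀`, so that the decoupling block scale `ℓ₀ = c'/δ` carries a weak block
coupling `g²(ℓ₀) → 0` as `μ → ∞`. -/
def LargeMassRateAt (Nf : ℕ) (reg : QCDRegularisation Nf) : Prop :=
  ∃ c : ℝ, 0 < c ∧ ∃ C₀ M₁ : ℝ, ∀ (m : Fin Nf → ℝ) (μ : ℝ), M₁ < μ → (∀ f, μ ≤ m f) →
    ∃ s C : ℝ, ClauseII reg m s (c * μ - C₀) C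

/-- **Quark locality** (the card's First lemma `almostSureQuarkLocality`, rate-generic): an averaged
pair-by-pair fractional-moment bound upgrades, by Tonelli and `∑_{v ∈ ℤ⁴} (1+‖v‖)^{-5} < ∞`, to a bound on
the weighted sum over all endpoints, uniformly in `k` and in the volume — the form a block-scale (Schur /
domain-decomposition) integration of the quarks consumes; the polynomial `(1+‖v‖)^5` in LATTICE units is
the honest entropy price (idea card obstruction (8): `H` replaces tuning, not the UV flow's bounds). -/
def QuarkLocalityAt (Nf : ℕ) (reg : QCDRegularisation Nf) : Prop :=
  ∀ (m : Fin Nf → ℝ) (s δ C : ℝ), ClauseII reg m s δ C →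
    ∃ C' : ℝ, ∀ᶠ k in atTop, ∀ S : ℕ, reg.L k ≤ S → ∀ f : Fin Nf, fmWeightedSum reg m s δ k S f ≤ C'

/-- **Lattice gap above a threshold along `reg`** (all tori `S ≥ L_k`, full sequence): for every mass tuple
above `M₀` one rate `Δ > 0` for the connected Euclidean-time correlations of ALL gauge-invariant local
lattice QCD observables in the HONEST (signed) theory at `reg`'s own bare parameters (the clause does not
see `z, shift`). -/
def LatticeGapAboveAt (Nf : ℕ) (reg : QCDRegularisation Nf) (M₀ : ℝ) : Prop :=
  ∀ m : Fin Nf → ℝ, (∀ f, M₀ < m f) → ∃ Δ : ℝ, 0 < Δ ∧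
    ∀ z shift : QCDField Nf → ℕ → ℝ, (reg.scheme m z shift).HasLatticeMassGap Δ

/-! ### §3 Registered stubs

Reshape (lead, cycle 1): the three provable stubs (`stub_cutoffWindow`, `stub_quarkLocality`, `stub_diagonal`) are
registered in UNFOLDED tree vocabulary (no skeleton-local name occurs in their signatures), so that their proofs land
as definition-free `Theorems/` files matching the registered text verbatim; `stub_cutoffWindow` moreover takes only
clause (iii) of `H` (the only clause its proof consumes) instead of the whole `HBody` — a STRONGER stub. The composition
converts them back to `CutoffWindowAt` / `QuarkLocalityAt` / `LocUnifSubseqBody → Body (subseqReg …)` by `rfl`-unfolding.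
The three open stubs keep the packaged vocabulary. -/

/-- `stub_cutoffWindow` — CLOSED (landed p72607, `Theorems/PauliWegnerSeaGluonicCompletionCutoffWindow.lean`). **H-trajectories are never lattice-massive**, stated from
clause (iii) ALONE (unfolded, verbatim the text of the crux): if for every positive mass tuple the phase-quenched
fractional moment of the flavour-`f` propagator between `0` and `n e₀` is bounded BELOW by
`c₀ e^{-C₁ a_k n}(n+1)^{-p}` on all tori `S ≥ L_k`, `n ≤ S`, eventually in `k`, then every bare Wilson mass
`m_crit(k) + a_k m_f/Z_m(k)` is eventually below every `ε > 0`. Proof route: if `m_f(k) ≥ ε` frequently, the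
tree's configuration-wise heavy-mass bound (`QuantumLattice.norm_inv_wilsonDirac_apply_le`: for bare mass `≥ ε > 0`,
`|D_W⁻¹(p,q)| ≤ ε⁻¹ (4/(ε+4))^{d₀(p,q)}`, every field, every torus; flavour-diagonal inverse
`QCDHeavyQuarkPropagator.inv_diracMatrix_apply_same_flavour` when all blocks are invertible, junk inverse `0`
otherwise) gives the UPPER bound `(144/ε)^s (4/(ε+4))^{s n}` for the same quotient (template:
`phaseQuenched_fractionalMoment_decay_of_heavy`); at `S = n = L_k → ∞` (`a_k L_k → ∞`, `a_k → 0`) the two bounds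
are incompatible since `C₁ a_k → 0 < s log((ε+4)/4)` and `p log(L_k+1) = o(L_k)`. Uses `H` at (iii) only. -/
theorem stub_cutoffWindow :
    ∀ (Nf : ℕ) (reg : QCDRegularisation Nf),
      (∀ m : Fin Nf → ℝ, (∀ f, 0 < m f) → ∃ s c₀ C₁ p : ℝ, 0 < s ∧ s < 1 ∧ 0 < c₀ ∧ ∀ᶠ k in atTop, ∀ S : ℕ, reg.L k ≤ S → ∀ (f : Fin Nf) (n : ℕ), n ≤ S → c₀ * Real.exp (-(C₁ * (reg.a k * n) + p * Real.log (n + 1))) ≤ (∫ U : GaugeConfig 4 (2 * S + 1) (Matrix.specialUnitaryGroup (Fin 3) ℂ), ‖(diracMatrix U fun fl => reg.mcrit k + reg.a k * m fl / reg.Zm k).det‖ * (∑ a : Fin 3, ∑ i : Fin 4, ∑ b : Fin 3, ∑ j : Fin 4, ‖(diracMatrix U fun fl => reg.mcrit k + reg.a k * m fl / reg.Zm k)⁻¹ (quarkEquiv (f, (Torus.proj (2 * S + 1) 0, a, i))) (quarkEquiv (f, (Torus.proj (2 * S + 1) (Pi.single 0 (n : ℤ)), b, j)))‖) ^ s ∂(wilsonMeasure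 (fundamentalRep (Fin 3)) (reg.β k))) / (∫ U : GaugeConfig 4 (2 * S + 1) (Matrix.specialUnitaryGroup (Fin 3) ℂ), ‖(diracMatrix U fun fl => reg.mcrit k + reg.a k * m fl / reg.Zm k).det‖ ∂(wilsonMeasure (fundamentalRep (Fin 3)) (reg.β k)))) →
        ∀ m : Fin Nf → ℝ, (∀ f, 0 < m f) → ∀ (f : Fin Nf) (ε : ℝ), 0 < ε →
          ∀ᶠ k in atTop, reg.mcrit k + reg.a k * m f / reg.Zm k < ε :=
  _root_.Summit.QuantumFields.QCD.Theorems.CertifiedSeaThresholdGraft.stub_cutoffWindow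

/-- `stub_largeMassRate` — **clause (ii) in the heavy corner at a rate linear in the lightest mass**
(open; strictly easier than the sibling crux stmt-QuantumFields-9150 — far from the critical band the
Combes–Thomas rate of `H_W(m_f(k))` is `≍ a_k(M₀ + κ μ)` in lattice units — but NOT implied by `H`, whose
`δ(m) > 0` carries no growth in `m`). Uses `H` at (i), (ii), (iii) [offset bounded] and the scaling
clauses. Why it might fail: rare near-real modes of `D_W` just above `m_crit(k)` (dislocations) at spectral
distance `≪ a_k μ / Z_m(k)` from the valence mass could cap the fractional-moment rate below the valence
scale; no Wegner estimate for `SU(3)` link disorder is known (WilsonMobilityGap.WegnerEstimate, stmt-8966). -/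
theorem stub_largeMassRate :
    ∀ (Nf : ℕ) (reg : QCDRegularisation Nf), HBody Nf reg → LargeMassRateAt Nf reg := by
  sorry

/-- `stub_quarkLocality` — CLOSED (landed p73061, `Theorems/PauliWegnerSeaGluonicCompletionQuarkLocality.lean`). **Almost-sure quark locality** (the card's First lemma), stated
in UNFOLDED tree vocabulary (it is `∀ Nf reg, QuarkLocalityAt Nf reg` with `ClauseII`, `fmMoment`, `fmWeightedSum`
unfolded): Tonelli on the finite sum over `v ∈ box 4 S` (phase-quenched expectation = integral against the
probability measure `qcdLatticeMeasure`, tree `qcdPhaseQuenchedExpect_eq_div` /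
`qcdPhaseQuenchedExpect_eq_integral_qcdLatticeMeasure`, integrability from
`QCDPhaseQuenchedMomentUpgrade.integrable_propagatorEntrySum_qcdLatticeMeasure` and `x^s ≤ 1 + x`), the pair bound
with weight `e^{δ a_k‖v‖/2}(1+‖v‖)^{-5}` against `C e^{-δ a_k ‖v‖}`, and
`∑_{v ∈ box 4 S} (1+‖v‖_∞)^{-5} ≤ (∑_{t ∈ ℤ} (1+|t|)^{-5/4})⁴ < ∞` uniformly in `S`; junk cases (zero denominator)
only help since `C' ≥ 0` may be enlarged. -/
theorem stub_quarkLocality :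
    ∀ (Nf : ℕ) (reg : QCDRegularisation Nf) (m : Fin Nf → ℝ) (s δ C : ℝ),
      (0 < s ∧ s < 1 ∧ 0 < δ ∧ ∀ᶠ k in atTop, ∀ S : ℕ, reg.L k ≤ S → ∀ (f : Fin Nf) (v : Literature.Probability.LatticeModels.Site 4), v ∈ box 4 S → (∫ U : GaugeConfig 4 (2 * S + 1) (Matrix.specialUnitaryGroup (Fin 3) ℂ), ‖(diracMatrix U fun fl => reg.mcrit k + reg.a k * m fl / reg.Zm k).det‖ * (∑ a : Fin 3, ∑ i : Fin 4, ∑ b : Fin 3, ∑ j : Fin 4, ‖(diracMatrix U fun fl => reg.mcrit k + reg.a k * m fl / reg.Zm k)⁻¹ (quarkEquiv (f, (Torus.proj (2 * S + 1) 0, a, i))) (quarkEquiv (f, (Torus.proj (2 * S + 1) (v), b, j)))‖) ^ s ∂(wilsonMeasure (fundamentalRep (Fin 3)) (reg.β k))) / (∫ U : GaugeConfig 4 (2 * S + 1) (Matrix.specialUnitaryGroup (Fin 3) ℂ), ‖(diracMatrix U fun fl => reg.mcrit k + reg.a k * m fl / reg.Zm k).det‖ ∂(wilsonMeasure (fundamentalRep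 (Fin 3)) (reg.β k))) ≤ C * Real.exp (-(δ * (reg.a k * ‖v‖)))) →
        ∃ C' : ℝ, ∀ᶠ k in atTop, ∀ S : ℕ, reg.L k ≤ S → ∀ f : Fin Nf,
          (∫ U : GaugeConfig 4 (2 * S + 1) (Matrix.specialUnitaryGroup (Fin 3) ℂ), ‖(diracMatrix U fun fl => reg.mcrit k + reg.a k * m fl / reg.Zm k).det‖ * ∑ v ∈ box 4 S, Real.exp (δ * (reg.a k * ‖v‖) / 2) * ((1 + ‖v‖) ^ 5)⁻¹ * (∑ a : Fin 3, ∑ i : Fin 4, ∑ b : Fin 3, ∑ j : Fin 4, ‖(diracMatrix U fun fl => reg.mcrit k + reg.a k * m fl / reg.Zm k)⁻¹ (quarkEquiv (f, (Torus.proj (2 * S + 1) 0, a, i))) (quarkEquiv (f, (Torus.proj (2 * S + 1) v, b, j)))‖) ^ s ∂(wilsonMeasure (fundamentalRep (Fin 3)) (reg.β k))) / (∫ U : GaugeConfig 4 (2 * S + 1) (Matrix.specialUnitaryGroup (Fin 3) ℂ), ‖(diracMatrix U fun fl => reg.mcrit k + reg.a k * m fl / reg.Zm k).det‖ ∂(wilsonMeasure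 (fundamentalRep (Fin 3)) (reg.β k))) ≤ C' :=
  _root_.Summit.QuantumFields.QCD.Theorems.CertifiedSeaThresholdGraft.stub_quarkLocality

/-- `stub_latticeGapAlongH` — **the all-volume lattice gap above a threshold along H's own regularisation**
(open; with `stub_continuumAlongH` the hardest). The graft proper, lattice half: run the gauge/fermion block
flow FORWARD along `reg`'s prescribed bare data `(a_k, β_k, m_crit(k), Z_m(k))` — no stable-manifold tuning:
`CutoffWindowAt` + clause (i) give the starting window, clause (iii) forbids lattice-heaviness at every
intermediate scale — down to the decoupling scale `ℓ₀ = c'/(c μ - C₀)` named by `LargeMassRateAt`;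
integrate the then block-heavy quarks by a Schur / domain-decomposition expansion fed by `QuarkLocalityAt`
(quark lines of physical length `ℓ` weigh `e^{-(cμ - C₀)ℓ/2}`); the `N_f = 3` / mass-split SIGN at `S > L_k`
rides as a dilute field of signed block activities of the RG-effective fermion operator (NOT as Dirichlet
sign-cutting of the fine `D_W`, which wall modes forbid — TRIAGE r1-2 (2), r1-3 (2)); the gluonic remainder is
the named condition of route HeavyThresholdYMBridge in its RG-level form (`RobustYangMillsRG`, #2′, to be
typed over D1′ `BlockScaleEffectivePerturbation`; the typed shadow `RobustYangMills` stmt-13897 does not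
admit block-level perturbations — its own header's trap T-sup). Why it might fail: it contains the
`SU(3)` Yang–Mills lattice gap in the coupling- and action-universal form along the matched `N_f = 0`
sequence (`CouplingMatching`, stmt-8797); block-diluteness of sign defects needs clause (iv)-type rarity at
`S > L_k`, which `H` pins only at `S = L_k`. -/
theorem stub_latticeGapAlongH :
    ∀ Nf : ℕ, Nf = 2 ∨ Nf = 3 → ∀ reg : QCDRegularisation Nf, HBody Nf reg →
      CutoffWindowAt Nf reg → LargeMassRateAt Nf reg → QuarkLocalityAt Nf reg →
        ∃ M₀ : ℝ, 0 ≤ M₀ ∧ LatticeGapAboveAt Nf reg M₀ := by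
  sorry

/-- `stub_continuumAlongH` — **subsequential continuum limit, OS axioms, non-triviality and the continuum
gap above a threshold along H's own regularisation, locally uniformly in `m`, given the lattice gap** (open).
The graft proper, `T`-side half: every clause here integrates at the scheme's OWN side `2L_k+1` only
(QCDOS: `qcdLatticeSchwinger` lives on `GaugeConfig 4 (sch.side k)`), the one volume where clause (iv) gives
`⟨σ⟩_{|w|} ≥ ½`, so every BOUND is a factor-2 reweighting of the positive phase-quenched ensemble (landed:
`Negative.qcdTorusExpect_eq_detRatio`, `Negative.detRatio_le_two_mul_absMoment`; norm-INSIDE quantities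
only, `Negative.reweighting_not_bookkeeping`) — UV stability of smeared `n`-point functions from the forward
flow, compactness (`∀ ψ ∃ φ`), OS axioms of the limit (E2 from Lüscher positivity at `m_f(k) > -1` = clause
(i) after the per/ap winding-line comparison `O(e^{-2(cμ-C₀)a_k(2S+1)})`, E1 through the robust-YM
condition), non-trivial non-Gaussian glue, `IsNontrivial (pseudoRe f g)` from the heavy flavour-changing
quark-line two-point function at `|x| ≈ 1/μ` with `z = Z_P(ℓ₀)`, `T.HasMassGap` from the lattice gap
`LatticeGapAboveAt` plus convergence, local `m`-uniformity from the convergent expansions. It does NOT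
consume the crux's phase-quenched flavour-decay clause (norm outside — unusable for signed statements,
Disproof g2 §7). Why it might fail: E1 restoration and non-Gaussianity are Yang–Mills-grade; the `∃ reg ∀ m`
order needs constants locally uniform in `m` (F3); flavour-blind `m_crit` vs split masses beyond
`O(g₀⁴)`-relative sea effects (ThresholdQCD's own why-fail). -/
theorem stub_continuumAlongH :
    ∀ Nf : ℕ, Nf = 2 ∨ Nf = 3 → ∀ reg : QCDRegularisation Nf, HBody Nf reg →
      CutoffWindowAt Nf reg → LargeMassRateAt Nf reg → QuarkLocalityAt Nf reg →
        ∀ M₀ : ℝ, 0 ≤ M₀ → LatticeGapAboveAt Nf reg M₀ →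
          ∃ M₁ : ℝ, M₀ ≤ M₁ ∧ LocUnifSubseqBody Nf reg M₁ := by
  sorry

/-- `stub_diagonal` — CLOSED (landed p73776, `Theorems/PauliWegnerSeaGluonicCompletionDiagonal.lean`). **One subsequence for all mass tuples** ( binds every line on this
crux, F3), stated in UNFOLDED tree vocabulary (it is `∀ Nf reg M₁, LocUnifSubseqBody Nf reg M₁ → ∃ φ hφ, ∀ m > M₁,
Body Nf (subseqReg reg φ hφ) m` with `LocUnifSubseqBody`, `Body`, `subseqReg` unfolded; the nested
`subseqReg (subseqReg reg ψ _) φ _` is written as the one literal `reg ∘ (ψ ∘ φ)`, definitionally equal):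
`{m | ∀ f, M₁ < m f}` is Lindelöf (second countable), so countably many of the neighbourhoods cover it; refine
subsequences successively (`Ψᵢ = Ψᵢ₋₁ ∘ φᵢ`) and take the diagonal `Φ j = Ψ_j j` (strictly increasing since
`φ j ≥ j`); for `j ≥ i`, `Φ = Ψᵢ ∘ θᵢ` on `[i, ∞)` with `θᵢ` strictly increasing, and the body is (a) hereditary
under exact subsequences (reindex `z, shift`; `qcdLatticeSchwinger` of `(reg ∘ φ).scheme m (z ∘ φ) (shift ∘ φ)`
at `k` IS that of `reg.scheme m z shift` at `φ k`, `rfl`) and (b) insensitive to finitely many initial terms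
(every clause is a `Tendsto`/`∀ᶠ` statement in `k`, and `qcdLatticeSchwinger ((reg ∘ Φ).scheme m z shift) k =
qcdLatticeSchwinger (reg.scheme m (fun s _ => z s k) (fun s _ => shift s k)) (Φ k)`, `rfl`, reads `Φ` only
through `Φ k`). -/
theorem stub_diagonal :
    ∀ (Nf : ℕ) (reg : QCDRegularisation Nf) (M₁ : ℝ),
      (∀ m₀ : Fin Nf → ℝ, (∀ f, M₁ < m₀ f) → ∃ ε : ℝ, 0 < ε ∧
        ∀ (ψ : ℕ → ℕ) (hψ : StrictMono ψ), ∃ (φ : ℕ → ℕ) (hφ : StrictMono φ),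
          ∀ m : Fin Nf → ℝ, (∀ f, M₁ < m f) → (∀ f, |m f - m₀ f| < ε) →
            ∃ (z shift : QCDField Nf → ℕ → ℝ) (T : OSData (QCDField Nf) 4), IsQCDAlong ((⟨fun k => reg.a (ψ (φ k)), fun k => reg.a_pos (ψ (φ k)), reg.tendsto_a.comp (hψ.comp hφ).tendsto_atTop, fun k => reg.β (ψ (φ k)), fun k => reg.L (ψ (φ k)), reg.tendsto_L.comp (hψ.comp hφ).tendsto_atTop, fun k => reg.mcrit (ψ (φ k)), fun k => reg.Zm (ψ (φ k)), fun k => reg.Zm_pos (ψ (φ k))⟩ : QCDRegularisation Nf).scheme m z shift) T ∧ T.IsNontrivial QCDField.glue ∧ T.IsNonGaussian QCDField.glue ∧ (∀ f g : Fin Nf, f ≠ g → T.IsNontrivial (QCDField.pseudoRe f g)) ∧ ∃ Δ > 0, T.HasMassGap Δ ∧ ((⟨fun k => reg.a (ψ (φ k)), fun k => reg.a_pos (ψ (φ k)), reg.tendsto_a.comp (hψ.comp hφ).tendsto_atTop, fun k => reg.β (ψ (φ k)), fun k => reg.L (ψ (φ k)), reg.tendsto_L.comp (hψ.comp hφ).tendsto_atTop,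 fun k => reg.mcrit (ψ (φ k)), fun k => reg.Zm (ψ (φ k)), fun k => reg.Zm_pos (ψ (φ k))⟩ : QCDRegularisation Nf).scheme m z shift).HasLatticeMassGap Δ) →
      ∃ (φ : ℕ → ℕ) (hφ : StrictMono φ), ∀ m : Fin Nf → ℝ, (∀ f, M₁ < m f) →
        ∃ (z shift : QCDField Nf → ℕ → ℝ) (T : OSData (QCDField Nf) 4), IsQCDAlong ((⟨fun k => reg.a (φ k), fun k => reg.a_pos (φ k), reg.tendsto_a.comp (hφ).tendsto_atTop, fun k => reg.β (φ k), fun k => reg.L (φ k), reg.tendsto_L.comp (hφ).tendsto_atTop, fun k => reg.mcrit (φ k), fun k => reg.Zm (φ k), fun k => reg.Zm_pos (φ k)⟩ : QCDRegularisation Nf).scheme m z shift) T ∧ T.IsNontrivial QCDField.glue ∧ T.IsNonGaussian QCDField.glue ∧ (∀ f g : Fin Nf, f ≠ g → T.IsNontrivial (QCDField.pseudoRe f g)) ∧ ∃ Δ > 0, T.HasMassGap Δ ∧ ((⟨fun k => reg.a (φ k), fun k => reg.a_pos (φ k), reg.tendsto_a.comp (hφ).tendsto_atTop, fun k => reg.β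 (φ k), fun k => reg.L (φ k), reg.tendsto_L.comp (hφ).tendsto_atTop, fun k => reg.mcrit (φ k), fun k => reg.Zm (φ k), fun k => reg.Zm_pos (φ k)⟩ : QCDRegularisation Nf).scheme m z shift).HasLatticeMassGap Δ :=
  _root_.Summit.QuantumFields.QCD.Theorems.CertifiedSeaThresholdGraft.stub_diagonal

/-! ### §4 The kernel-checked composition -/

/-- **Composition, closed form** (sorry-free, standard axioms): the six stub STATEMENTS imply the crux's unfolded form.
Unpack `H`'s regularisation `reg`; the cutoff window (from clause (iii) alone), the large-mass rate and quark locality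
feed the two halves of the graft, which return a threshold `M₁ ≥ 0` and a locally-`m`-uniform subsequential body along
`reg`; the diagonal stub extracts ONE subsequence `φ` serving every `m > M₁`; `subseqReg reg φ` keeps `HasMassScaling`,
and the landed threshold reading `Negative.qcdOf_iff_threshold` (shift `m_crit ↦ m_crit + a M₁/Z_m`) turns the
threshold body into `QCDOf N_f`. The unfolded stubs 0, 2, 5 are converted to the packaged currencies definitionally. -/
theorem composition_closed
    (h₀ : ∀ (Nf : ℕ) (reg : QCDRegularisation Nf),
        (∀ m : Fin Nf → ℝ, (∀ f, 0 < m f) → ∃ s c₀ C₁ p : ℝ, 0 < s ∧ s < 1 ∧ 0 < c₀ ∧ ∀ᶠ k in atTop, ∀ S : ℕ, reg.L k ≤ S → ∀ (f : Fin Nf) (n : ℕ), n ≤ S → c₀ * Real.exp (-(C₁ * (reg.a k * n) + p * Real.log (n + 1))) ≤ (∫ U : GaugeConfig 4 (2 * S + 1) (Matrix.specialUnitaryGroup (Fin 3) ℂ), ‖(diracMatrix U fun fl => reg.mcrit k + reg.a k * m fl / reg.Zm k).det‖ * (∑ a : Fin 3, ∑ i : Fin 4, ∑ b : Fin 3, ∑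 j : Fin 4, ‖(diracMatrix U fun fl => reg.mcrit k + reg.a k * m fl / reg.Zm k)⁻¹ (quarkEquiv (f, (Torus.proj (2 * S + 1) 0, a, i))) (quarkEquiv (f, (Torus.proj (2 * S + 1) (Pi.single 0 (n : ℤ)), b, j)))‖) ^ s ∂(wilsonMeasure (fundamentalRep (Fin 3)) (reg.β k))) / (∫ U : GaugeConfig 4 (2 * S + 1) (Matrix.specialUnitaryGroup (Fin 3) ℂ), ‖(diracMatrix U fun fl => reg.mcrit k + reg.a k * m fl / reg.Zm k).det‖ ∂(wilsonMeasure (fundamentalRep (Fin 3)) (reg.β k)))) →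
          ∀ m : Fin Nf → ℝ, (∀ f, 0 < m f) → ∀ (f : Fin Nf) (ε : ℝ), 0 < ε →
            ∀ᶠ k in atTop, reg.mcrit k + reg.a k * m f / reg.Zm k < ε)
    (h₁ : ∀ (Nf : ℕ) (reg : QCDRegularisation Nf), HBody Nf reg → LargeMassRateAt Nf reg)
    (h₂ : ∀ (Nf : ℕ) (reg : QCDRegularisation Nf) (m : Fin Nf → ℝ) (s δ C : ℝ),
        (0 < s ∧ s < 1 ∧ 0 < δ ∧ ∀ᶠ k in atTop, ∀ S : ℕ, reg.L k ≤ S → ∀ (f : Fin Nf) (v : Literature.Probability.LatticeModels.Site 4), v ∈ box 4 S → (∫ U : GaugeConfig 4 (2 * S + 1) (Matrix.specialUnitaryGroup (Fin 3) ℂ), ‖(diracMatrix U fun fl => reg.mcrit k + reg.a k * m fl / reg.Zm k).det‖ * (∑ a : Fin 3, ∑ i : Fin 4, ∑ b : Fin 3, ∑ j : Fin 4, ‖(diracMatrix U fun fl => reg.mcrit k + reg.a k * m fl / reg.Zm k)⁻¹ (quarkEquiv (f, (Torus.proj (2 * S + 1) 0, a, i))) (quarkEquiv (f, (Torus.proj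 (2 * S + 1) (v), b, j)))‖) ^ s ∂(wilsonMeasure (fundamentalRep (Fin 3)) (reg.β k))) / (∫ U : GaugeConfig 4 (2 * S + 1) (Matrix.specialUnitaryGroup (Fin 3) ℂ), ‖(diracMatrix U fun fl => reg.mcrit k + reg.a k * m fl / reg.Zm k).det‖ ∂(wilsonMeasure (fundamentalRep (Fin 3)) (reg.β k))) ≤ C * Real.exp (-(δ * (reg.a k * ‖v‖)))) →
          ∃ C' : ℝ, ∀ᶠ k in atTop, ∀ S : ℕ, reg.L k ≤ S → ∀ f : Fin Nf,
            (∫ U : GaugeConfig 4 (2 * S + 1) (Matrix.specialUnitaryGroup (Fin 3) ℂ), ‖(diracMatrix U fun fl => reg.mcrit k + reg.a k * m fl / reg.Zm k).det‖ * ∑ v ∈ box 4 S, Real.exp (δ * (reg.a k * ‖v‖) / 2) * ((1 + ‖v‖) ^ 5)⁻¹ * (∑ a : Fin 3, ∑ i : Fin 4, ∑ b : Fin 3, ∑ j : Fin 4, ‖(diracMatrix U fun fl => reg.mcrit k + reg.a k * m fl / reg.Zm k)⁻¹ (quarkEquiv (f, (Torus.proj (2 * S + 1) 0, a, i))) (quarkEquiv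 (f, (Torus.proj (2 * S + 1) v, b, j)))‖) ^ s ∂(wilsonMeasure (fundamentalRep (Fin 3)) (reg.β k))) / (∫ U : GaugeConfig 4 (2 * S + 1) (Matrix.specialUnitaryGroup (Fin 3) ℂ), ‖(diracMatrix U fun fl => reg.mcrit k + reg.a k * m fl / reg.Zm k).det‖ ∂(wilsonMeasure (fundamentalRep (Fin 3)) (reg.β k))) ≤ C')
    (h₃ : ∀ Nf : ℕ, Nf = 2 ∨ Nf = 3 → ∀ reg : QCDRegularisation Nf, HBody Nf reg →
      CutoffWindowAt Nf reg → LargeMassRateAt Nf reg → QuarkLocalityAt Nf reg →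
        ∃ M₀ : ℝ, 0 ≤ M₀ ∧ LatticeGapAboveAt Nf reg M₀)
    (h₄ : ∀ Nf : ℕ, Nf = 2 ∨ Nf = 3 → ∀ reg : QCDRegularisation Nf, HBody Nf reg →
      CutoffWindowAt Nf reg → LargeMassRateAt Nf reg → QuarkLocalityAt Nf reg →
        ∀ M₀ : ℝ, 0 ≤ M₀ → LatticeGapAboveAt Nf reg M₀ →
          ∃ M₁ : ℝ, M₀ ≤ M₁ ∧ LocUnifSubseqBody Nf reg M₁)
    (h₅ : ∀ (Nf : ℕ) (reg : QCDRegularisation Nf) (M₁ : ℝ),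
        (∀ m₀ : Fin Nf → ℝ, (∀ f, M₁ < m₀ f) → ∃ ε : ℝ, 0 < ε ∧
          ∀ (ψ : ℕ → ℕ) (hψ : StrictMono ψ), ∃ (φ : ℕ → ℕ) (hφ : StrictMono φ),
            ∀ m : Fin Nf → ℝ, (∀ f, M₁ < m f) → (∀ f, |m f - m₀ f| < ε) →
              ∃ (z shift : QCDField Nf → ℕ → ℝ) (T : OSData (QCDField Nf) 4), IsQCDAlong ((⟨fun k => reg.a (ψ (φ k)), fun k => reg.a_pos (ψ (φ k)), reg.tendsto_a.comp (hψ.comp hφ).tendsto_atTop, fun k => reg.β (ψ (φ k)), fun k => reg.L (ψ (φ k)), reg.tendsto_L.comp (hψ.comp hφ).tendsto_atTop, fun k => reg.mcrit (ψ (φ k)), fun k => reg.Zm (ψ (φ k)), fun k => reg.Zm_pos (ψ (φ k))⟩ : QCDRegularisation Nf).scheme m z shift) T ∧ T.IsNontrivial QCDField.glue ∧ T.IsNonGaussian QCDField.glue ∧ (∀ f g : Fin Nf, f ≠ g → T.IsNontrivial (QCDField.pseudoRe f g)) ∧ ∃ Δ > 0, T.HasMassGap Δ ∧ ((⟨fun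 k => reg.a (ψ (φ k)), fun k => reg.a_pos (ψ (φ k)), reg.tendsto_a.comp (hψ.comp hφ).tendsto_atTop, fun k => reg.β (ψ (φ k)), fun k => reg.L (ψ (φ k)), reg.tendsto_L.comp (hψ.comp hφ).tendsto_atTop, fun k => reg.mcrit (ψ (φ k)), fun k => reg.Zm (ψ (φ k)), fun k => reg.Zm_pos (ψ (φ k))⟩ : QCDRegularisation Nf).scheme m z shift).HasLatticeMassGap Δ) →
        ∃ (φ : ℕ → ℕ) (hφ : StrictMono φ), ∀ m : Fin Nf → ℝ, (∀ f, M₁ < m f) →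
          ∃ (z shift : QCDField Nf → ℕ → ℝ) (T : OSData (QCDField Nf) 4), IsQCDAlong ((⟨fun k => reg.a (φ k), fun k => reg.a_pos (φ k), reg.tendsto_a.comp (hφ).tendsto_atTop, fun k => reg.β (φ k), fun k => reg.L (φ k), reg.tendsto_L.comp (hφ).tendsto_atTop, fun k => reg.mcrit (φ k), fun k => reg.Zm (φ k), fun k => reg.Zm_pos (φ k)⟩ : QCDRegularisation Nf).scheme m z shift) T ∧ T.IsNontrivial QCDField.glue ∧ T.IsNonGaussian QCDField.glue ∧ (∀ f g : Fin Nf, f ≠ g → T.IsNontrivial (QCDField.pseudoRe f g)) ∧ ∃ Δ > 0, T.HasMassGap Δ ∧ ((⟨fun k => reg.a (φ k), fun k => reg.a_pos (φ k), reg.tendsto_a.comp (hφ).tendsto_atTop, fun k => reg.β (φ k), fun k => reg.L (φ k), reg.tendsto_L.comp (hφ).tendsto_atTop, fun k => reg.mcrit (φ k), fun k => reg.Zm (φ k), fun k => reg.Zm_pos (φ k)⟩ : QCDRegularisation Nf).scheme m z shift).HasLatticeMassGap Δ) :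
    ∀ Nf : ℕ, Nf = 2 ∨ Nf = 3 → (∃ reg : QCDRegularisation Nf, HBody Nf reg) → QCDOf Nf := by
  intro Nf hNf hH
  obtain ⟨reg, hreg⟩ := hH
  have hMS : reg.HasMassScaling := hreg.1
  have hW : CutoffWindowAt Nf reg := h₀ Nf reg fun m hm => (hreg.2.2 m hm).1.2.2.1
  have hL : LargeMassRateAt Nf reg := h₁ Nf reg hreg
  have hQ : QuarkLocalityAt Nf reg := fun m s δ C hC => h₂ Nf reg m s δ C hC
  obtain ⟨M₀, hM₀, hgap⟩ := h₃ Nf hNf reg hreg hW hL hQ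
  obtain ⟨M₁, hM₁, hloc⟩ := h₄ Nf hNf reg hreg hW hL hQ M₀ hM₀ hgap
  obtain ⟨φ, hφ, hbody⟩ := h₅ Nf reg M₁ hloc
  exact (qcdOf_iff_threshold_body Nf).2
    ⟨M₁, hM₀.trans hM₁, subseqReg reg φ hφ, hasMassScaling_subseqReg reg φ hφ hMS, hbody⟩

/-- **The skeleton theorem**: the crux BY NAME from the six registered stubs (its only non-whitelisted axiom is the
`sorryAx` of the stubs; `composition_closed` is the sorry-free logic). -/
theorem GluonicCompletion_of : Summit.QuantumFields.QCD.Theses.PauliWegnerSea.GluonicCompletion :=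
  gluonicCompletion_iff.2
    (composition_closed stub_cutoffWindow stub_largeMassRate stub_quarkLocality stub_latticeGapAlongH
      stub_continuumAlongH stub_diagonal)

/-- The same for the SHARED copy of the crux in route WilsonMobilityGap (the two decls are `rfl`-equal:
Disproof.lean `eq_wilsonMobilityGap`). -/
theorem GluonicCompletion_of_wilsonMobilityGap :
    Summit.QuantumFields.QCD.Theses.WilsonMobilityGap.GluonicCompletion :=
  GluonicCompletion_of

end

end Summit.QuantumFields.QCD.Cruxes.GluonicCompletion.CertifiedSeaThresholdGraft
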